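import Literature.AnabelianGeometry.EtaleTheta.Discharge.Sec1ZNTransportOfSplitting
import Literature.AnabelianGeometry.EtaleTheta.Discharge.Sec1Thm16GKNKummer
import Literature.AnabelianGeometry.EtaleTheta.SettingModelChiZNStandardSplitting
import HarnessLib

/-!
# [EtTh] §1 p. 14: the STRUCTURE of the origin clause `GtpZNFromSplitting` — «all splittings determine
# the same splitting over `G_{J_N}`» isolated as the Kummer-theoretic conjunct, and `Gal(J_N/K_N)` is
# abelian of exponent dividing `N`

Mochizuki, *The étale theta function and its Frobenioid-theoretic manifestations*, Publ. RIMS **45**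
(2009), §1, PRIMS PDF p. 14 (kurims p. 13): "`J_N := K_N(a^{1/N})_{a ∈ K_N}` … Since any two splittings of
this exact sequence differ by a cohomology class `∈ H¹(G_{K_N}, ℤ/Nℤ(1))`, it follows [by the definition of
`J_N`] that all splittings of this exact sequence determine the same splitting over `G_{J_N}`"
[cite: MochizukiEtTh2009, §1 p.14].

abc-iut cell, layer L2, seat abc-iut-L2-t1 (§1 ROOT owner, gen 6). PROOF-ONLY companion (no definition,
no `Prop`-valued definition, no new named fact) of the gen-5 origin-clause file
`ThetaSettingZNFromSplitting.lean` (p446335: `GtpZNFromSplitting D N` quantifies over ALL lifted splittings),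
of `Sec1ZNTransportOfSplitting.lean` (p454350, this seat), of abc-iut-w5-d051's `Sec1Thm16GKNKummer.lean`
(p420414-lineage: `Thm16Sub.mem_GKN_iff`) and of abc-iut-L2-d1's model witness
`SettingModelChiZNStandardSplitting.lean` (p448964: the ∃-form at `modelχ`), all consumed BY NAME.

(A) THE CLAUSE SPLITS INTO AN ∃-HALF AND A UNIQUENESS HALF (plain group theory over the root):
* `ThetaSetting.gtpZN_clause_of_agree` — the printed characterisation of `Π^tp_{Z_N}` passes from one
  lifted splitting to another agreeing with it on `G_{J_N}` modulo `N·(Δ^tp_Y)^Θ`;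
* `ThetaSetting.splittings_agree_of_gtpZNFromSplitting` — conversely the ∀-form forces any two lifted
  splittings to agree on `G_{J_N}` modulo `N·(Δ^tp_Y)^Θ`;
* **`ThetaSetting.gtpZNFromSplitting_and_exists_iff`** — `GtpZNFromSplitting D N ∧ (a lifted splitting
  exists)` ⟺ (∃-form: SOME lifted splitting cuts out `Π^tp_{Z_N}` — the shape witnessed at the models) ∧
  («all splittings determine the same splitting over `G_{J_N}`»: any two lifted splittings agree on `G_{J_N}`
  modulo `N·(Δ^tp_Y)^Θ` — print's Kummer sentence, stated inline);
* **`ThetaSetting.gtpZNFromSplitting_modelχ_iff_agree`** — hence AT THE χ-MODEL (where abc-iut-L2-d1's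
  `exists_thetaSplitting_gtpZN_iff_modelχ` supplies the ∃-half) the ∀-form predicate is EQUIVALENT to the
  uniqueness half alone: this is the exact kernel location of FINDING F-L2d1g5-1 (abstract vs continuous
  splittings; L2-lead R405).
(B) «[by the definition of `J_N`]», the Galois side over Mathlib (`G_{ℚ_p} = Gal(ℚ̄_p/ℚ_p)`, fixing subgroups):
* `ThetaSetting.mem_GJN_iff` — `σ ∈ G_{J_N} ↔ σ ∈ G_{K_N} ∧ σ` fixes every `N`-th root of every element of
  `K_N` (the `J_N`-twin of w5-d051's `mem_GKN_iff`);
* `ThetaSetting.apply_pow_eq_of_mem_GKN`, `exists_pow_eq_one_apply_eq`, `apply_comm_of_mem_GKN` — for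
  `σ ∈ G_{K_N}` and `r^N ∈ K_N`: `σ r = ζ·r` with `ζ^N = 1` (fixed by `G_{K_N}` ∋ `ζ_N`), so elements of
  `G_{K_N}` commute on such `r`;
* **`ThetaSetting.commutator_mem_GJN`**, **`ThetaSetting.pow_mem_GJN`** — `[G_{K_N}, G_{K_N}] · G_{K_N}^N ⊆
  G_{J_N}`: "`Gal(J_N/K_N)`" (p. 14) is abelian of exponent dividing `N` — the easy half of the Kummer
  description; the hard half (`J_N` is the MAXIMAL such extension: every continuous character of `G_{K_N}`
  of order dividing `N` dies on `G_{J_N}`, Mathlib `exists_root_adjoin_eq_top_of_isCyclic`) is what the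
  uniqueness half of (A) needs for CONTINUOUS splittings, and is not typed here.

HONEST FRAMING: [EtTh] is refereed; nothing asserted; typed ≠ proved; the semi-synthetic χ-model is
consistency evidence only; nothing here bears on [IUTchIII] Cor. 3.12.
-/

noncomputable section

namespace Literature.AnabelianGeometry.EtaleTheta

open Literature.AnabelianGeometry.SemiGraphs

namespace ThetaSetting

variable {p : ℕ} [Fact p.Prime]

/-! ### (A) The ∃-half and the uniqueness half of `GtpZNFromSplitting` -/

section Clause

variable (D : ThetaSetting p) (N : ℕ+)

/-- The printed characterisation of `Π^tp_{Z_N}` passes between lifted splittings that agree on `G_{J_N}`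
modulo `N·(Δ^tp_Y)^Θ`. [cite: MochizukiEtTh2009, §1 p.14] -/
theorem gtpZN_clause_of_agree {s s' : ↥(D.GKN N) → D.GtpTheta}
    (hagree : ∀ (σ : GQp p) (hσ : σ ∈ D.GJN N),
      s ⟨σ, D.GJN_le_GKN N hσ⟩ * (s' ⟨σ, D.GJN_le_GKN N hσ⟩)⁻¹ ∈ D.thetaPowersY N)
    (hs : ∀ g : D.PiTemp, g ∈ D.GtpZN N ↔ g ∈ D.GtpYN N ∧ ∃ h : D.aug g ∈ D.GJN N,
      D.toTheta g * (s ⟨D.aug g, D.GJN_le_GKN N h⟩)⁻¹ ∈ D.thetaPowersY N) (g : D.PiTemp) :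
    g ∈ D.GtpZN N ↔ g ∈ D.GtpYN N ∧ ∃ h : D.aug g ∈ D.GJN N,
      D.toTheta g * (s' ⟨D.aug g, D.GJN_le_GKN N h⟩)⁻¹ ∈ D.thetaPowersY N := by
  rw [hs g]
  refine and_congr_right fun _ => exists_congr fun h => ?_
  have ha := hagree (D.aug g) h
  have e₁ : D.toTheta g * (s' ⟨D.aug g, D.GJN_le_GKN N h⟩)⁻¹ =
      D.toTheta g * (s ⟨D.aug g, D.GJN_le_GKN N h⟩)⁻¹ *
        (s ⟨D.aug g, D.GJN_le_GKN N h⟩ * (s' ⟨D.aug g, D.GJN_le_GKN N h⟩)⁻¹) := by group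
  have e₂ : D.toTheta g * (s ⟨D.aug g, D.GJN_le_GKN N h⟩)⁻¹ =
      D.toTheta g * (s' ⟨D.aug g, D.GJN_le_GKN N h⟩)⁻¹ *
        (s ⟨D.aug g, D.GJN_le_GKN N h⟩ * (s' ⟨D.aug g, D.GJN_le_GKN N h⟩)⁻¹)⁻¹ := by group
  constructor
  · intro hm
    rw [e₁]
    exact Subgroup.mul_mem _ hm ha
  · intro hm
    rw [e₂]
    exact Subgroup.mul_mem _ hm (Subgroup.inv_mem _ ha)

/-- The ∀-form `GtpZNFromSplitting D N` forces any two lifted splittings to agree on `G_{J_N}` modulo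
`N·(Δ^tp_Y)^Θ` («all splittings … determine the same splitting over `G_{J_N}`», p. 14; via a lift of `σ` to
`Π^tp_{Z_N}`, root field `map_aug_GtpZN`). [cite: MochizukiEtTh2009, §1 p.14] -/
theorem splittings_agree_of_gtpZNFromSplitting (hz : D.GtpZNFromSplitting N)
    {s s' : ↥(D.GKN N) → D.GtpTheta} (hs : D.IsThetaSplittingAt N s) (hs' : D.IsThetaSplittingAt N s')
    {σ : GQp p} (hσ : σ ∈ D.GJN N) :
    s ⟨σ, D.GJN_le_GKN N hσ⟩ * (s' ⟨σ, D.GJN_le_GKN N hσ⟩)⁻¹ ∈ D.thetaPowersY N := by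
  obtain ⟨g, hgZ, hgσ⟩ := Thm16Sub.exists_mem_GtpZN_aug_eq D N hσ
  subst hgσ
  obtain ⟨-, h₁, hm₁⟩ := (hz s hs g).1 hgZ
  obtain ⟨-, h₂, hm₂⟩ := (hz s' hs' g).1 hgZ
  have e₁ : D.toTheta g * (s ⟨D.aug g, D.GJN_le_GKN N hσ⟩)⁻¹ ∈ D.thetaPowersY N := hm₁
  have e₂ : D.toTheta g * (s' ⟨D.aug g, D.GJN_le_GKN N hσ⟩)⁻¹ ∈ D.thetaPowersY N := hm₂
  have eq : s ⟨D.aug g, D.GJN_le_GKN N hσ⟩ * (s' ⟨D.aug g, D.GJN_le_GKN N hσ⟩)⁻¹ =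
      (D.toTheta g * (s ⟨D.aug g, D.GJN_le_GKN N hσ⟩)⁻¹)⁻¹ *
        (D.toTheta g * (s' ⟨D.aug g, D.GJN_le_GKN N hσ⟩)⁻¹) := by group
  rw [eq]
  exact Subgroup.mul_mem _ (Subgroup.inv_mem _ e₁) e₂

/-- ∃-form + agreement on `G_{J_N}` ⇒ the ∀-form `GtpZNFromSplitting D N`. [cite: MochizukiEtTh2009, §1 p.14] -/
theorem gtpZNFromSplitting_of_exists_of_agree
    (hex : ∃ s : ↥(D.GKN N) → D.GtpTheta, D.IsThetaSplittingAt N s ∧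
      ∀ g : D.PiTemp, g ∈ D.GtpZN N ↔ g ∈ D.GtpYN N ∧ ∃ h : D.aug g ∈ D.GJN N,
        D.toTheta g * (s ⟨D.aug g, D.GJN_le_GKN N h⟩)⁻¹ ∈ D.thetaPowersY N)
    (hagree : ∀ s s' : ↥(D.GKN N) → D.GtpTheta, D.IsThetaSplittingAt N s → D.IsThetaSplittingAt N s' →
      ∀ (σ : GQp p) (hσ : σ ∈ D.GJN N),
        s ⟨σ, D.GJN_le_GKN N hσ⟩ * (s' ⟨σ, D.GJN_le_GKN N hσ⟩)⁻¹ ∈ D.thetaPowersY N) :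
    D.GtpZNFromSplitting N := by
  obtain ⟨s, hs, hcl⟩ := hex
  intro s' hs' g
  exact gtpZN_clause_of_agree D N (fun σ hσ => hagree s s' hs hs' σ hσ) hcl g

/-- **The structure of the origin clause for `Z_N`** (p. 14): `GtpZNFromSplitting D N` together with the
existence of a lifted splitting is EQUIVALENT to the conjunction of the ∃-form "some lifted splitting cuts out
`Π^tp_{Z_N}`" (witnessed at the models) and print's Kummer sentence «all splittings … determine the same
splitting over `G_{J_N}`» (any two lifted splittings agree on `G_{J_N}` modulo `N·(Δ^tp_Y)^Θ`).
[cite: MochizukiEtTh2009, §1 p.14] -/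
theorem gtpZNFromSplitting_and_exists_iff :
    (D.GtpZNFromSplitting N ∧ ∃ s : ↥(D.GKN N) → D.GtpTheta, D.IsThetaSplittingAt N s) ↔
      (∃ s : ↥(D.GKN N) → D.GtpTheta, D.IsThetaSplittingAt N s ∧
        ∀ g : D.PiTemp, g ∈ D.GtpZN N ↔ g ∈ D.GtpYN N ∧ ∃ h : D.aug g ∈ D.GJN N,
          D.toTheta g * (s ⟨D.aug g, D.GJN_le_GKN N h⟩)⁻¹ ∈ D.thetaPowersY N) ∧
      ∀ s s' : ↥(D.GKN N) → D.GtpTheta, D.IsThetaSplittingAt N s → D.IsThetaSplittingAt N s' →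
        ∀ (σ : GQp p) (hσ : σ ∈ D.GJN N),
          s ⟨σ, D.GJN_le_GKN N hσ⟩ * (s' ⟨σ, D.GJN_le_GKN N hσ⟩)⁻¹ ∈ D.thetaPowersY N := by
  constructor
  · rintro ⟨hz, s, hs⟩
    exact ⟨⟨s, hs, hz s hs⟩, fun s s' hs hs' σ hσ => splittings_agree_of_gtpZNFromSplitting D N hz hs hs' hσ⟩
  · rintro ⟨hex, hagree⟩
    obtain ⟨s, hs, hcl⟩ := hex
    exact ⟨gtpZNFromSplitting_of_exists_of_agree D N ⟨s, hs, hcl⟩ hagree, s, hs⟩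

end Clause

/-- **At the χ-model the ∀-form IS the uniqueness half** (abc-iut-L2-d1's
`exists_thetaSplitting_gtpZN_iff_modelχ` supplies the ∃-half): `GtpZNFromSplitting (modelχ p) N` holds iff
any two (abstract) lifted splittings agree on `G_{J_N}` modulo `N·(Δ^tp_Y)^Θ` — the exact location of
FINDING F-L2d1g5-1. [cite: MochizukiEtTh2009, §1 p.14] -/
theorem gtpZNFromSplitting_modelχ_iff_agree (p : ℕ) [Fact p.Prime] (N : ℕ+) :
    (ThetaSetting.modelχ p).GtpZNFromSplitting N ↔
      ∀ s s' : ↥((ThetaSetting.modelχ p).GKN N) → (ThetaSetting.modelχ p).GtpTheta,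
        (ThetaSetting.modelχ p).IsThetaSplittingAt N s → (ThetaSetting.modelχ p).IsThetaSplittingAt N s' →
        ∀ (σ : GQp p) (hσ : σ ∈ (ThetaSetting.modelχ p).GJN N),
          s ⟨σ, (ThetaSetting.modelχ p).GJN_le_GKN N hσ⟩ *
            (s' ⟨σ, (ThetaSetting.modelχ p).GJN_le_GKN N hσ⟩)⁻¹ ∈ (ThetaSetting.modelχ p).thetaPowersY N := by
  have hex := SettingModel.exists_thetaSplitting_gtpZN_iff_modelχ p N
  constructor
  · intro hz
    obtain ⟨s, hs, -⟩ := hex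
    exact ((gtpZNFromSplitting_and_exists_iff _ N).1 ⟨hz, s, hs⟩).2
  · intro hagree
    exact gtpZNFromSplitting_of_exists_of_agree _ N hex hagree

/-! ### (B) «[by the definition of `J_N`]»: `G_{J_N}` unfolded; `Gal(J_N/K_N)` abelian of exponent `N` -/

section Kummer

/-- An `F`-automorphism of `E` fixes `F(S)` pointwise iff it fixes `S` pointwise (private Galois plumbing, as in
abc-iut-w5-d051's `Sec1Thm16GKNKummer`). [folklore] -/
private theorem mem_fixingSubgroup_adjoin_iff' {F E : Type*} [Field F] [Field E] [Algebra F E] (S : Set E)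
    (σ : E ≃ₐ[F] E) : σ ∈ (IntermediateField.adjoin F S).fixingSubgroup ↔ ∀ x ∈ S, σ x = x := by
  rw [IntermediateField.mem_fixingSubgroup_iff]
  refine ⟨fun h x hx => h x (IntermediateField.subset_adjoin F S hx), fun h x hx => ?_⟩
  have hle : IntermediateField.adjoin F S ≤ IntermediateField.fixedField (Subgroup.zpowers σ) := by
    rw [IntermediateField.adjoin_le_iff]
    intro y hy
    rw [SetLike.mem_coe, IntermediateField.mem_fixedField_iff]
    intro f hf
    have hσ : σ ∈ MulAction.stabilizer (E ≃ₐ[F] E) y := by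
      rw [MulAction.mem_stabilizer_iff, AlgEquiv.smul_def]
      exact h y hy
    have hf' : f ∈ MulAction.stabilizer (E ≃ₐ[F] E) y := (Subgroup.zpowers_le.mpr hσ) hf
    rw [MulAction.mem_stabilizer_iff, AlgEquiv.smul_def] at hf'
    exact hf'
  have hx' := hle hx
  rw [IntermediateField.mem_fixedField_iff] at hx'
  exact hx' σ (Subgroup.mem_zpowers σ)

variable (D : ThetaSetting p)

/-- **`G_{J_N} = Gal(K̄/K_N(a^{1/N})_{a ∈ K_N})` unfolded** (p. 14): `σ ∈ G_{J_N}` iff `σ ∈ G_{K_N}` and `σ` fixes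
every `N`-th root (in `ℚ̄_p`) of every element of `K_N`. [cite: MochizukiEtTh2009, §1 p.14] -/
theorem mem_GJN_iff (N : ℕ+) (σ : GQp p) :
    σ ∈ D.GJN N ↔ σ ∈ D.GKN N ∧
      ∀ r : PadicAlgCl p, r ^ (N : ℕ) ∈ fieldKN D.K D.qX N → σ r = r := by
  change σ ∈ (fieldJN D.K D.qX N).fixingSubgroup ↔ σ ∈ (fieldKN D.K D.qX N).fixingSubgroup ∧ _
  rw [fieldJN, mem_fixingSubgroup_adjoin_iff', IntermediateField.mem_fixingSubgroup_iff]
  constructor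
  · intro h
    exact ⟨fun x hx => h x (Or.inl hx), fun r hr => h r (Or.inr hr)⟩
  · rintro ⟨hK, hr⟩ x (hx | hx)
    · exact hK x hx
    · exact hr x hx

/-- For `σ ∈ G_{K_N}` and `r^N ∈ K_N`: `(σ r)^N = r^N`. [cite: MochizukiEtTh2009, §1 p.14] -/
theorem apply_pow_eq_of_mem_GKN (N : ℕ+) {σ : GQp p} (hσ : σ ∈ D.GKN N) {r : PadicAlgCl p}
    (hr : r ^ (N : ℕ) ∈ fieldKN D.K D.qX N) : σ r ^ (N : ℕ) = r ^ (N : ℕ) := by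
  have h : σ ∈ (fieldKN D.K D.qX N).fixingSubgroup := hσ
  rw [IntermediateField.mem_fixingSubgroup_iff] at h
  rw [← map_pow]
  exact h _ hr

/-- For `σ ∈ G_{K_N}` and `r^N ∈ K_N`: `σ r = ζ · r` for an `N`-th root of unity `ζ` (Kummer).
[cite: MochizukiEtTh2009, §1 p.14] -/
theorem exists_pow_eq_one_apply_eq (N : ℕ+) {σ : GQp p} (hσ : σ ∈ D.GKN N) {r : PadicAlgCl p}
    (hr : r ^ (N : ℕ) ∈ fieldKN D.K D.qX N) : ∃ ζ : PadicAlgCl p, ζ ^ (N : ℕ) = 1 ∧ σ r = ζ * r := by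
  by_cases h0 : r = 0
  · exact ⟨1, one_pow _, by rw [h0, map_zero, mul_zero]⟩
  · refine ⟨σ r * r⁻¹, ?_, by rw [inv_mul_cancel_right₀ h0]⟩
    rw [mul_pow, apply_pow_eq_of_mem_GKN D N hσ hr, inv_pow, mul_inv_cancel₀ (pow_ne_zero _ h0)]

/-- Elements of `G_{K_N}` commute on the `N`-th roots of elements of `K_N` (`ζ_N ∈ K_N` is fixed by `G_{K_N}`).
[cite: MochizukiEtTh2009, §1 p.14] -/
theorem apply_comm_of_mem_GKN (N : ℕ+) {σ τ : GQp p} (hσ : σ ∈ D.GKN N) (hτ : τ ∈ D.GKN N)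
    {r : PadicAlgCl p} (hr : r ^ (N : ℕ) ∈ fieldKN D.K D.qX N) : σ (τ r) = τ (σ r) := by
  obtain ⟨ζ, hζ, hσr⟩ := exists_pow_eq_one_apply_eq D N hσ hr
  obtain ⟨ξ, hξ, hτr⟩ := exists_pow_eq_one_apply_eq D N hτ hr
  have hσξ : σ ξ = ξ := ((Thm16Sub.mem_GKN_iff D N σ).1 hσ).2.1 ξ hξ
  have hτζ : τ ζ = ζ := ((Thm16Sub.mem_GKN_iff D N τ).1 hτ).2.1 ζ hζ
  rw [hτr, map_mul, hσξ, hσr, map_mul, hτζ, hτr]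
  ring

/-- **Commutators of `G_{K_N}` lie in `G_{J_N}`**: "`Gal(J_N/K_N)`" (p. 14) is abelian.
[cite: MochizukiEtTh2009, §1 p.14] -/
theorem commutator_mem_GJN (N : ℕ+) {σ τ : GQp p} (hσ : σ ∈ D.GKN N) (hτ : τ ∈ D.GKN N) :
    σ * τ * σ⁻¹ * τ⁻¹ ∈ D.GJN N := by
  rw [mem_GJN_iff]
  refine ⟨Subgroup.mul_mem _ (Subgroup.mul_mem _ (Subgroup.mul_mem _ hσ hτ) (Subgroup.inv_mem _ hσ))
    (Subgroup.inv_mem _ hτ), fun r hr => ?_⟩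
  have hx : (τ⁻¹ r) ^ (N : ℕ) ∈ fieldKN D.K D.qX N := by
    rw [apply_pow_eq_of_mem_GKN D N (Subgroup.inv_mem _ hτ) hr]
    exact hr
  have h1 : τ (σ⁻¹ (τ⁻¹ r)) = σ⁻¹ (τ (τ⁻¹ r)) := apply_comm_of_mem_GKN D N hτ (Subgroup.inv_mem _ hσ) hx
  have h2 : τ (τ⁻¹ r) = r := by rw [← AlgEquiv.mul_apply, mul_inv_cancel, AlgEquiv.one_apply]
  have h3 : σ (σ⁻¹ r) = r := by rw [← AlgEquiv.mul_apply, mul_inv_cancel, AlgEquiv.one_apply]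
  rw [AlgEquiv.mul_apply, AlgEquiv.mul_apply, AlgEquiv.mul_apply, h1, h2, h3]

/-- **`N`-th powers of `G_{K_N}` lie in `G_{J_N}`**: "`Gal(J_N/K_N)`" (p. 14) has exponent dividing `N`.
[cite: MochizukiEtTh2009, §1 p.14] -/
theorem pow_mem_GJN (N : ℕ+) {σ : GQp p} (hσ : σ ∈ D.GKN N) : σ ^ (N : ℕ) ∈ D.GJN N := by
  rw [mem_GJN_iff]
  refine ⟨Subgroup.pow_mem _ hσ _, fun r hr => ?_⟩
  obtain ⟨ζ, hζ, hσr⟩ := exists_pow_eq_one_apply_eq D N hσ hr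
  have key : ∀ k : ℕ, (σ ^ k) r = ζ ^ k * r := by
    intro k
    induction k with
    | zero => rw [pow_zero, pow_zero, AlgEquiv.one_apply, one_mul]
    | succ k ih =>
      have hfix : (σ ^ k) ζ = ζ := ((Thm16Sub.mem_GKN_iff D N (σ ^ k)).1 (Subgroup.pow_mem _ hσ k)).2.1 ζ hζ
      rw [pow_succ, AlgEquiv.mul_apply, hσr, map_mul, hfix, ih, pow_succ]
      ring
  rw [key, hζ, one_mul]

end Kummer

end ThetaSetting

end Literature.AnabelianGeometry.EtaleTheta

end
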